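import Mathlib.RingTheory.MvPolynomial.WeightedHomogeneous
import Mathlib.RingTheory.FiniteType
import Mathlib.RingTheory.RegularLocalRing.Polynomial
import Mathlib.Algebra.Order.Antidiag.Finsupp
import Literature.AlgebraicGeometry.Resolution.AffineBlowupAlgebra
import Literature.AlgebraicGeometry.Resolution.AffineBlowup
import HarnessLib

/-!
# Powers of the generators of the Veronese vertex ideal are divisible by the `xᵢʳ`

Support file for crux stmt-ResolutionOfSingularities-15317 (`FrobeniusLadder.FRationalResolution`), line `redirect`,
lead c5, CONE PROGRAMME (rung 4′ in all dimensions on the Veronese cones `V(n,r) = Spec k[χᵈ : |d| = r]`).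
For a degree-`r` monomial `s = χᵈ` in the Veronese subring `VR[n,r]` (a generator of the vertex
ideal `VM[n,r]`), picking `i` with `dᵢ ≥ 1` gives the monomial identity `sʳ = xᵢʳ · q` with
`q = χ^{r(d − eᵢ)}` a product of `r − 1` degree-`r` monomials, hence `q ∈ VM[n,r]^(r−1)`; this is
the input of the generic sub-cover criterion showing that the charts at the `xᵢʳ` cover the
blow-up of the vertex. [folklore]
-/

-- single-problem summit: the doubled namespace component is forced
set_option linter.dupNamespace false

noncomputable section

namespace Summit.ResolutionOfSingularities.ResolutionOfSingularities.Theorems.FRationalResolution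

open MvPolynomial
open Literature.AlgebraicGeometry.Resolution

section Cones

variable (k : Type) [Field k]

/-- The polynomial ring in `n` variables. -/
local notation3 "MP[" n "]" => MvPolynomial (Fin n) k

/-- The `r`-th Veronese subring of `k[x₁,…,xₙ]`: the `k`-subalgebra generated by the degree-`r` monomials. -/
local notation3 "VR[" n ", " r "]" =>
  Algebra.adjoin k ((fun d : Fin n →₀ ℕ => MvPolynomial.monomial d (1 : k)) ''
    {d : Fin n →₀ ℕ | Finsupp.degree d = (r : ℕ)})

/-- The vertex ideal of the Veronese cone: spanned by the degree-`r` monomials. -/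
local notation3 "VM[" n ", " r "]" =>
  Ideal.span {v : ↥VR[n, r] | ∃ d : Fin n →₀ ℕ, Finsupp.degree d = (r : ℕ) ∧
    (v : MvPolynomial (Fin n) k) = MvPolynomial.monomial d 1}

/-- **Powers of vertex-ideal generators (Veronese cone).** For a degree-`r` monomial
`s = χᵈ ∈ VR[n,r]` (`|d| = r ≥ 1`) there are `i`, `N` (namely `N = r - 1`) and `q ∈ VM[n,r]^N` with
`s^(N+1) = xᵢʳ · q`. Proof: pick `i` with `dᵢ ≥ 1` and write `d = eᵢ + d'`; then
`r • d = r • eᵢ + r • d'`, and `r • d'` has degree `r(r-1)`, so by the splitting hypothesis it is a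
sum of `r - 1` exponent vectors of degree `r`; the corresponding product `q` of `r - 1` degree-`r`
monomials lies in `VM^(r-1)` and `(χᵈ)ʳ = χ^{r•d} = xᵢʳ · q`. [folklore] -/
theorem stub_veronese_pow (n r : ℕ) (hr : 1 ≤ r)
    (hsplit : ∀ (s : ℕ) (d : Fin n →₀ ℕ), Finsupp.degree d = r * s →
      ∃ e : Fin s → (Fin n →₀ ℕ), (∀ j, Finsupp.degree (e j) = r) ∧ d = ∑ j, e j)
    (g : Fin n → ↥VR[n, r]) (hg : ∀ i, ((g i : ↥VR[n, r]) : MP[n]) = MvPolynomial.X i ^ r)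
    (s : ↥VR[n, r]) (d : Fin n →₀ ℕ) (hd : Finsupp.degree d = r)
    (hs : (s : MP[n]) = MvPolynomial.monomial d 1) :
    ∃ i, ∃ N : ℕ, ∃ q ∈ VM[n, r] ^ N, s ^ (N + 1) = g i * q := by
  classical
  -- some exponent `d i` is positive
  have hd0 : d ≠ 0 := by
    rintro rfl
    rw [map_zero] at hd
    omega
  obtain ⟨i, hi⟩ := Finsupp.support_nonempty_iff.mpr hd0
  rw [Finsupp.mem_support_iff] at hi
  -- split off `eᵢ`: `d = single i 1 + d'`
  obtain ⟨d', rfl⟩ : ∃ d', d = Finsupp.single i 1 + d' :=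
    le_iff_exists_add.mp (Finsupp.single_le_iff.mpr (Nat.one_le_iff_ne_zero.mpr hi))
  rw [map_add, Finsupp.degree_single] at hd
  have hdeg : Finsupp.degree (r • d') = r * (r - 1) := by
    have h' : Finsupp.degree d' = r - 1 := by omega
    rw [map_nsmul, smul_eq_mul, h']
  obtain ⟨e, he, hsum⟩ := hsplit (r - 1) (r • d') hdeg
  -- the `r - 1` degree-`r` monomial factors, as elements of the Veronese subring
  have hmem : ∀ j, (MvPolynomial.monomial (e j) (1 : k) : MP[n]) ∈ VR[n, r] := fun j =>
    Algebra.subset_adjoin ⟨e j, he j, rfl⟩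
  refine ⟨i, r - 1, ∏ j, ⟨MvPolynomial.monomial (e j) 1, hmem j⟩, ?_, ?_⟩
  · have hq : (∏ j, ⟨MvPolynomial.monomial (e j) 1, hmem j⟩ : ↥VR[n, r]) ∈
        ∏ _j : Fin (r - 1), VM[n, r] :=
      Ideal.prod_mem_prod fun j _ => Ideal.subset_span ⟨e j, he j, rfl⟩
    rwa [Finset.prod_const, Finset.card_univ, Fintype.card_fin] at hq
  · rw [Nat.sub_add_cancel hr]
    apply Subtype.ext
    rw [Subalgebra.coe_pow, Subalgebra.coe_mul, SubmonoidClass.coe_finsetProd, hs, hg,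
      MvPolynomial.monomial_pow, one_pow, MvPolynomial.X_pow_eq_monomial,
      ← MvPolynomial.monomial_sum_one, ← hsum, MvPolynomial.monomial_mul, one_mul, smul_add,
      Finsupp.smul_single_one]

end Cones

end Summit.ResolutionOfSingularities.ResolutionOfSingularities.Theorems.FRationalResolution

end
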